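import Literature.NumberTheory.EllipticCurves.AgasheRibetStein2006.ManinConstantOptimalCurves
import Mathlib.NumberTheory.Padics.PadicVal.Basic
import HarnessLib

/-!
# The Manin constant of every optimal curve of conductor `≤ 300000` is `1` — Cremona's verification of the Manin conjecture, as cited in print by Česnavičius–Neururer–Saha (JEMS 26 (2024), §1)

HONEST FRAMING (cell `b2b-bsdres`, run/shared/lean/b2b/bsd-rank1-residual/; verbatim in every file):
the cell deletes the COMBINATION-SHAPED residual classes of the BSD formula in analytic rank `≤ 1`
from PUBLISHED theorems only and TYPES the construction-shaped ones; this is not "finishing BSD".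
Literature seat (cell lead / registry `HOME/CITED-FACTS.md`), generation 112, answering the by-name
ask A-O5-G31-2 of the O5 planner seat `o5-r2` GEN 31 (HOME/INBOX 2026-08-23T15:26Z / 15:28Z). ONE
named fact (`def … : Prop`, nothing asserted; D-0014) and three proved corollaries; census /
database rows stay EVIDENCE; nothing is booked; no count moves.

## What is here, and what the tree already had

The sibling `AgasheRibetStein2006/ManinConstantOptimalCurves.lean` vendors Agashe–Ribet–Stein,
PAMQ 2 (2006), **Thm. 2.6 (Cremona)** — "If `E` is an optimal elliptic curve over `ℚ` with
conductor at most `130000`, then `c_E = 1`" — as the named fact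
`AgasheRibetStein2006.cremona_abs_maninConstant_eq_one_of_level_le` (bound `N ≤ 130000`). Cremona
continued the SAME computation (full modular-symbol spaces; appendix §5 of op. cit.) past `130000`
and documents it in the elliptic-curve database `ecdata`; the refereed paper of Česnavičius–Neururer–
Saha cites that documentation as its reference [Cre19] for the statement that the full Manin
conjecture is known for every isogeny class of conductor `N ≤ 300000`. THIS file vendors exactly that
sentence, in the word-for-word rendering of the sibling (only the numeral changes:
`130000 ↦ 300000`):

* `cremona_abs_maninConstant_eq_one_of_level_le_300000` — THE NAMED FACT: for every globally minimal
  model `W'/ℚ` of an elliptic curve and every OPTIMAL parametrisation datum `D'` at level `N'`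
  (`Λ_{E'} ⊆ c Λ_f`), `N' ≤ 300000 → |c| = 1`.
* `cremona_abs_maninConstant_eq_one_of_level_le_of_le_300000` — PROVED: the new fact implies the
  sibling's (`130000 ≤ 300000`); the two registry rows are therefore one statement at two bounds, not
  two independent inputs.
* `not_dvd_maninConstant_of_level_le_300000`, `padicValInt_maninConstant_eq_zero_of_level_le_300000`
  — PROVED corollary shapes: no prime divides such a `c`; `ord_p c = 0` (the binder shape
  `hcD : padicValInt 3 D.maninConstant = 0` of the consumer below).

## Citation header (read by this seat, 2026-08-23)

SECONDARY (refereed, in print; the sentence vendored):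
* K. Česnavičius, M. Neururer, A. Saha, *The Manin constant and the modular degree*, J. Eur. Math.
  Soc. **26** (2024), no. 2, 573–637, doi:10.4171/jems/1367 (bib key `CesnaviciusNeururerSaha2023`);
  held text `paper:arxiv-1911.09446` (corpus-tex, `page_kind: chunk`; locators below are TEXT CHUNKS
  per the registry's reading rule RR-1, not journal pages) = arXiv v3 (the accepted version; TeX
  source `manin-paper.tex` of the arXiv e-print read line by line by this seat).
* Verbatim, §1 (text chunk 3 L70 = TeX source l. 957): "To illustrate, in the following figure we
  plotted in green the fraction of those isogeny classes of `E` over `ℚ` of conductor `N ≤ 300000`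
  that have an odd additive prime `p` but for which no such `p` divides `deg φ`, where `φ` is the
  optimal parametrization by `X₀(N)_ℚ`; […]." and (text chunk 3 L72 = TeX l. 974): "**Even though in
  all of these small conductor cases the full Manin conjecture is known by Cremona's verification
  [Cre19]**, the figure shows the scope of the improvement supplied by Theorems 1.1 and 1.2."
  Footnote of the same § (TeX l. 955): "although it is only for optimal `φ` that the Manin constant
  `c_φ` is conjectured to equal `±1` (and known to be divisible only by the primes of additive
  reduction)". The Manin conjecture of op. cit. §1 (TeX l. 884–888): "For optimal `φ`, Manin
  conjectured that `c_φ = ±1`, see [Man71, Section 10.3]", where (TeX l. 871–877) "`φ^*(ω_E) = c_φ · ω_f`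
  for a unique `c_φ ∈ ℚ^×`, and one knows that `c_φ ∈ ℤ` (we abuse notation: `ω_E` is nonunique, so `φ`
  determines only `±c_φ`)", `ω_E` a Néron differential, `ω_f` the differential form of the normalised
  newform `f` (`2πi f(τ) dτ` for `Γ₀(N)`), and "optimal" (TeX l. 882) = "`deg(φ)` the least possible as
  `E` varies in its isogeny class and `Γ` is fixed".
* Bibliography entry of op. cit., verbatim: "[Cre19] John Cremona, *Manin constants and optimal
  curves*, 2022. Accessed at https://johncremona.github.io/ecdata/manin.txt on January 27, 2022."

PRIMARY ([Cre19]; database documentation, NOT refereed — held and read; bib key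
`Cremona2022ManinConstants`):
* J. E. Cremona, *Manin constants and optimal curves*, file `manin.txt` of the elliptic curve
  database `ecdata` (github.com/JohnCremona/ecdata); hub copy
  `run/shared/lean/speedrun/kurihara/ecdata/manin.txt` (GitHub `master`, fetched 2026-08-18; sha256
  `c40b604636bca07367d8ea247e01d8eaa82ff70165200f006d85e4211380f477`; text dated "as of 26 November
  2019"). Verbatim, ¶1: "For all conductors (levels) `N` up to `60000`, and for specific levels up to
  `500000`, we have computed the full modular symbol space for `Γ₀(N)`, and not only the plus space,
  in order to determine which curve in the isogeny class is the `Γ₀(N)`-optimal one and to determine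
  the Manin constants. […] The justification for these claims is in the Appendix (written by me) to
  'The Manin Constant' by Amod Agashe, Ken Ribet and William Stein [Pure and Applied Mathematics
  Quarterly, Vol. 2 no.2 (2006), pp. 617-636.]" ¶2: "In the 'Cremona labels' of the curves in each
  isogeny class, curve number `1` is the `Γ₀(N)`-optimal curve, with the following provisos: – in
  class `990h` the optimal curve is `990h3` […] – for `16436` conductors above `400000` (as of 26
  November 2019), the optimal curve has not yet been determined […]." ¶ "Concerning the Manin
  constant": "the methods described in the paper (op.cit.) have been used to show that the Manin
  constant is `1` for every optimal curve. The theoretical results on the Manin constant `c` which we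
  have used are: that `c` is an integer, that `c = 2` is impossible when `N` is odd, and that `c = 3`
  is impossible unless `N` is a multiple of `3`."

READING, stated for the referee (registry flag `CNS24-range-reading`): "all of these small conductor
cases" is read as the population of the figure it comments — the isogeny classes of conductor
`N ≤ 300000` (the fractions plotted are fractions OF that population) — which is the range in which
the primary documents both halves of the conjecture (optimal curve determined, `c = 1`) without
proviso. The fact below is stated for that range and for nothing larger. (No elliptic curve over `ℚ`
has conductor exactly `300000 = 2⁵·3·5⁵`, so "`≤`" versus "`<`" is immaterial.)

## Hypotheses, enumerated (word for word → tree vocabulary; identical to the sibling's list)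

1. "the optimal parametrization by `X₀(N)_ℚ`" of "isogeny classes of `E` over `ℚ` of conductor `N`" —
   a globally minimal `W'/ℚ` (Néron differential read on a minimal model), elliptic, with a
   parametrisation datum `D' : ModularParametrizationData W' N'` (its newform `D'.f` has
   `IsNewformOf W' D'.f`, so `N' = N_{W'}` is the conductor) which is OPTIMAL: `Λ_{E'} ⊆ c Λ_f`, i.e.
   `∀ z ∈ D'.L.lattice, ∃ w ∈ periodLattice D'.f, z = D'.c * w` (with the structure field
   `c Λ_f ⊆ Λ_{E'}` this is `c Λ_f = Λ_{E'}`, `E' ≅ ℂ/Λ_f = E_f` the optimal quotient) — EXACTLY the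
   rendering of `cremona_abs_maninConstant_eq_one_of_level_le`, `mazur_not_dvd_maninConstant_of_odd`,
   `abbesUllmo_…`, `cesnavicius_…`.
2. "conductor `N ≤ 300000`" — `N' ≤ 300000`.
3. "the full Manin conjecture is known", i.e. `c_φ = ±1` — `|D'.maninConstant| = 1`
   (`D'.maninConstant = D'.c : ℤ`).

No `_holds` is to be expected (a finite but massive modular-symbol computation over every isogeny
class of conductor `≤ 300000`). Registry tier (HOME/CITED-FACTS.md): PUB[sec] — located through a refereed
secondary statement; primary = database documentation, held and read (flag `CRE19-db-primary`).

## Use, and what is deliberately NOT here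

Consumer (by name, D-0026): the O5 `KL3` signed trace rows of `o5-r2` GEN 31
(`HOME/b2b-bsdres-o5-r2/gen31/lean/HeegnerLogTransportThreeTraceRowsManin.lean`), whose record-side
binder `hcD : padicValInt 3 D.maninConstant = 0` (with the displayed optimality binder `hopt`) is
discharged BY NAME from `padicValInt_maninConstant_eq_zero_of_level_le_300000` on the three records of
conductor `≤ 300000`: `240930b1` (`N = 240930`), `149895d1` (`149895`), `162288ei1` (`162288`).
NOT covered and NOT vendored: the three records `430425o1`, `439569bw1`, `439569e1` (`N > 400000`):
there the ONLY located source is the primary itself (`opt_man` rows with optimality code `1` and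
`c = 1`, read by `o5-r2` GEN 31, `gen31/census/ecdata_opt_man_kl3rows.txt`) — database rows with no
refereed restatement in that range; they stay EVIDENCE and `hcD` stays a displayed binder there. Also
NOT here: any "curve numbered `1` is optimal" table sentence beyond the printed range `N < 60000` of
ARS 2006 appendix Thm. 5.2 (the `opt_man` optimality codes are data, not a printed theorem); the
`X₁(N)` conjecture of Stevens; anything at `N > 300000`.

## References
* [CesnaviciusNeururerSaha2023] K. Česnavičius, M. Neururer, A. Saha, *The Manin constant and the
  modular degree*, J. Eur. Math. Soc. 26 (2024), no. 2, 573–637, doi:10.4171/jems/1367;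
  arXiv:1911.09446v3, §1 (text chunk 3 L70–72) and bibliography entry [Cre19].
* [Cremona2022ManinConstants] J. E. Cremona, *Manin constants and optimal curves*, `ecdata/manin.txt`,
  https://johncremona.github.io/ecdata/manin.txt (= [Cre19] of the previous item), ¶1–2 and
  ¶ "Concerning the Manin constant".
* [AgasheRibetStein2006] A. Agashe, K. Ribet, W. A. Stein, *The Manin constant*, appendix by
  J. E. Cremona, Pure Appl. Math. Q. 2 (2006) 617–636: Thm. 2.6, appendix §5 (the method).
* Cell files: HOME/INBOX.md (o5-r2 GEN 31 close + P.S. 2), `b2b-bsdres-o5-r2/gen31/O5-GEN31.md` §G31-6,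
  HOME/CITED-FACTS.md (lit seat GEN 112 block).
-/

noncomputable section

open scoped MatrixGroups ModularForm

open CongruenceSubgroup UpperHalfPlane Literature.NumberTheory.EllipticCurves.ModularForms

namespace Literature.NumberTheory.EllipticCurves

/-- **Cremona's verification that `c = ±1` for every optimal curve of conductor `≤ 300000`, as cited
by Česnavičius–Neururer–Saha, JEMS 26 (2024), §1** — "[for] isogeny classes of `E` over `ℚ` of
conductor `N ≤ 300000` […] `φ` the optimal parametrization by `X₀(N)_ℚ` […] in all of these small
conductor cases the full Manin [statement `c_φ = ±1`] is known by Cremona's verification [Cre19]", where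
`φ^*(ω_E) = c_φ · ω_f` (`ω_E` a Néron differential, `ω_f = 2πi f(τ) dτ`); [Cre19] = Cremona, *Manin
constants and optimal curves* (`ecdata/manin.txt`): "the methods described in the paper
[Agashe–Ribet–Stein 2006, appendix] have been used to show that the Manin constant is `1` for every
optimal curve". Lattice rendering, word for word that of
`AgasheRibetStein2006.cremona_abs_maninConstant_eq_one_of_level_le` (the same sentence at the printed
bound `130000` of ARS 2006 Thm. 2.6): for every globally minimal model `W'/ℚ` of an elliptic curve,
every parametrisation datum `D'` at level `N'` (= `N_{W'}`) with `Λ_{E'} ⊆ c Λ_f` (so `φ_{D'}` is the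
optimal parametrisation and `c = D'.maninConstant ∈ ℤ` its Manin constant), if `N' ≤ 300000` then
`|c| = 1`. Named fact (statement only: a COMPLETED modular-symbol computation over all `N ≤ 300000`,
asserted in a refereed text; not an open question). Secondary source refereed and in print; primary
source = database documentation (held, read). [cite: CesnaviciusNeururerSaha2023, §1 (arXiv v3 text chunk 3 L70–72; their ref. Cre19 = Cremona2022ManinConstants, ¶ "Concerning the Manin constant")] -/
def cremona_abs_maninConstant_eq_one_of_level_le_300000 : Prop :=
  ∀ (W' : WeierstrassCurve ℚ) [W'.IsElliptic] [W'.IsGloballyMinimal] {N' : ℕ} [NeZero N']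
    (D' : ModularParametrizationData W' N'),
    (∀ z ∈ D'.L.lattice, ∃ w ∈ periodLattice D'.f, z = D'.c * w) →
    N' ≤ 300000 → |D'.maninConstant| = 1

/-- The statement at bound `300000` implies the sibling's statement at the printed bound `130000` of
Agashe–Ribet–Stein 2006 Thm. 2.6 (`130000 ≤ 300000`): the two named facts are ONE sentence at two
bounds. [cite: CesnaviciusNeururerSaha2023, §1; AgasheRibetStein2006, Thm. 2.6] -/
theorem cremona_abs_maninConstant_eq_one_of_level_le_of_le_300000
    (h : cremona_abs_maninConstant_eq_one_of_level_le_300000) :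
    AgasheRibetStein2006.cremona_abs_maninConstant_eq_one_of_level_le :=
  fun W' _ _ _ _ D' hopt hN => h W' D' hopt (le_trans hN (by norm_num))

/-- Corollary shape: under the fact, no prime divides the Manin constant of an optimal
parametrisation datum at level `≤ 300000` (proof word for word that of
`AgasheRibetStein2006.not_dvd_maninConstant_of_level_le`). [cite: CesnaviciusNeururerSaha2023, §1] -/
theorem not_dvd_maninConstant_of_level_le_300000
    (h : cremona_abs_maninConstant_eq_one_of_level_le_300000)
    (W' : WeierstrassCurve ℚ) [W'.IsElliptic] [W'.IsGloballyMinimal] {N' : ℕ} [NeZero N']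
    (D' : ModularParametrizationData W' N')
    (hopt : ∀ z ∈ D'.L.lattice, ∃ w ∈ periodLattice D'.f, z = D'.c * w) (hN : N' ≤ 300000)
    {p : ℕ} (hp : p.Prime) : ¬ (p : ℤ) ∣ D'.c := by
  intro hdvd
  have h1 : |D'.c| = 1 := h W' D' hopt hN
  have h2 : (p : ℤ) ∣ 1 := h1 ▸ (dvd_abs _ _).mpr hdvd
  have h3 : (p : ℤ) = 1 := Int.eq_one_of_dvd_one (by positivity) h2
  exact hp.one_lt.ne' (by exact_mod_cast h3)

/-- Corollary in the binder shape of the O5 `KL3` trace rows (`hcD : padicValInt 3 D.maninConstant = 0`):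
under the fact, `ord_p c(D') = 0` for every prime `p` and every optimal parametrisation datum `D'` at
level `≤ 300000`. [cite: CesnaviciusNeururerSaha2023, §1] -/
theorem padicValInt_maninConstant_eq_zero_of_level_le_300000
    (h : cremona_abs_maninConstant_eq_one_of_level_le_300000)
    (W' : WeierstrassCurve ℚ) [W'.IsElliptic] [W'.IsGloballyMinimal] {N' : ℕ} [NeZero N']
    (D' : ModularParametrizationData W' N')
    (hopt : ∀ z ∈ D'.L.lattice, ∃ w ∈ periodLattice D'.f, z = D'.c * w) (hN : N' ≤ 300000)
    (p : ℕ) [hp : Fact p.Prime] : padicValInt p D'.maninConstant = 0 :=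
  padicValInt.eq_zero_of_not_dvd (not_dvd_maninConstant_of_level_le_300000 h W' D' hopt hN hp.out)

/-! ### The same sentence at the PUBLISHED bound `500000` (JEMS final version, §1 p. 2)

The arXiv text vendored above (chunk 3 L70–72, figure paragraph) carries the bound `300000` with
the reference [Cre19]. The PUBLISHED version of the same §1 — authors' final version of 27 March
2022 (held full text `paper:url-5d7cab36bb8f`, 51 pp.; its abstract is word for word the JEMS/zbMATH
abstract zbl:1556.11059, whereas the earlier arXiv abstract differs), p. 2 — prints, verbatim,
the STRONGER sentence: "indeed, Cremona used the computational approach to prove in [Cre22] that the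
Manin conjecture holds whenever `N ≤ 500000`. The divergence of the two approaches gives this
overwhelming computational evidence for the Manin conjecture even more weight." with
"[Cre22] John Cremona, *Manin constants and optimal curves* (2022). Accessed at
https://johncremona.github.io/ecdata/manin.txt on January 27, 2022" (p. 49; = bib key
`Cremona2022ManinConstants`, hub copy `run/shared/lean/speedrun/kurihara/ecdata/manin.txt`),
and on p. 3 keeps the figure sentence at `N ≤ 300000` ("in all of these small conductor cases the
full Manin conjecture is known by Cremona's verification [Cre22]"). Here "the Manin conjecture" is
(p. 2) "For optimal `φ`, Manin conjectured that `c_φ = ±1`, see [Man71, Section 10.3]" with "Manin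
considered `Γ = Γ₀(N)`" (fn. 2) and optimal = "`deg(φ)` the least possible as `E` varies in its
isogeny class and `Γ` is fixed". PRIMARY-SOURCE CAVEAT (for the referee, not part of the printed
sentence): manin.txt (text "as of 26 November 2019") says the full modular symbol space was computed
"for all conductors `N` up to 60000, and for specific levels up to 500000", that "the Manin constant
is 1 for every optimal curve", and that for 64249 isogeny classes of conductor `> 400000` the
optimal curve within the class was not yet determined ("in almost all cases … it is possible to
deduce that the Manin constant for the optimal curve is 1 even when there is more than one possible
optimal curve"). The named fact below vendors the REFEREED sentence at its printed bound, in the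
word-for-word rendering of the two siblings (only the numeral changes: `300000 ↦ 500000`); it
implies both siblings (proved below). -/

/-- **Cremona's verification that `c = ±1` for every optimal curve of conductor `≤ 500000`, as cited
in print by Česnavičius–Neururer–Saha, JEMS 26 (2024), §1 (published text, p. 2)** — "Cremona used
the computational approach to prove in [Cre22] that the Manin [statement `c_φ = ±1` for optimal
`φ : X₀(N)_ℚ ↠ E`, `φ^*(ω_E) = c_φ · ω_f`] holds whenever `N ≤ 500000`". Lattice rendering, word for word that of
`cremona_abs_maninConstant_eq_one_of_level_le_300000` and of
`AgasheRibetStein2006.cremona_abs_maninConstant_eq_one_of_level_le` (bounds `300000`, `130000`): for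
every globally minimal model `W'/ℚ` of an elliptic curve, every parametrisation datum `D'` at
level `N'` with `Λ_{E'} ⊆ c Λ_f` (so `φ_{D'}` is the optimal parametrisation and
`c = D'.maninConstant` its Manin constant), if `N' ≤ 500000` then `|c| = 1`. Named fact (statement
only: a completed modular-symbol computation asserted in a refereed text; primary source = database
documentation
[Cre22] with the caveat recorded in the section docstring above). Secondary source refereed and in
print (full text held, `paper:url-5d7cab36bb8f` p. 2 and [Cre22] on p. 49).
[cite: CesnaviciusNeururerSaha2023, §1 p. 2 (published text) and ref. [Cre22]; Cremona2022ManinConstants, ¶ "Concerning the Manin constant"] -/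
def cremona_abs_maninConstant_eq_one_of_level_le_500000 : Prop :=
  ∀ (W' : WeierstrassCurve ℚ) [W'.IsElliptic] [W'.IsGloballyMinimal] {N' : ℕ} [NeZero N']
    (D' : ModularParametrizationData W' N'),
    (∀ z ∈ D'.L.lattice, ∃ w ∈ periodLattice D'.f, z = D'.c * w) →
    N' ≤ 500000 → |D'.maninConstant| = 1

/-- The statement at the published bound `500000` implies the statement at the arXiv bound `300000`
(`300000 ≤ 500000`): ONE sentence at two bounds. [cite: CesnaviciusNeururerSaha2023, §1 p. 2–3] -/
theorem cremona_abs_maninConstant_eq_one_of_level_le_300000_of_le_500000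
    (h : cremona_abs_maninConstant_eq_one_of_level_le_500000) :
    cremona_abs_maninConstant_eq_one_of_level_le_300000 :=
  fun W' _ _ _ _ D' hopt hN => h W' D' hopt (le_trans hN (by norm_num))

/-- … and hence the sibling's statement at the printed bound `130000` of Agashe–Ribet–Stein 2006
Thm. 2.6. [cite: CesnaviciusNeururerSaha2023, §1 p. 2; AgasheRibetStein2006, Thm. 2.6] -/
theorem cremona_abs_maninConstant_eq_one_of_level_le_of_le_500000
    (h : cremona_abs_maninConstant_eq_one_of_level_le_500000) :
    AgasheRibetStein2006.cremona_abs_maninConstant_eq_one_of_level_le :=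
  cremona_abs_maninConstant_eq_one_of_level_le_of_le_300000
    (cremona_abs_maninConstant_eq_one_of_level_le_300000_of_le_500000 h)

/-- Corollary shape: under the fact, no prime divides the Manin constant of an optimal
parametrisation datum at level `≤ 500000`. [cite: CesnaviciusNeururerSaha2023, §1 p. 2] -/
theorem not_dvd_maninConstant_of_level_le_500000
    (h : cremona_abs_maninConstant_eq_one_of_level_le_500000)
    (W' : WeierstrassCurve ℚ) [W'.IsElliptic] [W'.IsGloballyMinimal] {N' : ℕ} [NeZero N']
    (D' : ModularParametrizationData W' N')
    (hopt : ∀ z ∈ D'.L.lattice, ∃ w ∈ periodLattice D'.f, z = D'.c * w) (hN : N' ≤ 500000)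
    {p : ℕ} (hp : p.Prime) : ¬ (p : ℤ) ∣ D'.c := by
  intro hdvd
  have h1 : |D'.c| = 1 := h W' D' hopt hN
  have h2 : (p : ℤ) ∣ 1 := h1 ▸ (dvd_abs _ _).mpr hdvd
  have h3 : (p : ℤ) = 1 := Int.eq_one_of_dvd_one (by positivity) h2
  exact hp.one_lt.ne' (by exact_mod_cast h3)

/-- Corollary in the binder shape `hcD : padicValInt p D.maninConstant = 0`: under the fact,
`ord_p c(D') = 0` for every prime `p` and every optimal parametrisation datum `D'` at level
`≤ 500000` — the whole conductor range `N < 5·10⁵` of the cells' registers.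
[cite: CesnaviciusNeururerSaha2023, §1 p. 2] -/
theorem padicValInt_maninConstant_eq_zero_of_level_le_500000
    (h : cremona_abs_maninConstant_eq_one_of_level_le_500000)
    (W' : WeierstrassCurve ℚ) [W'.IsElliptic] [W'.IsGloballyMinimal] {N' : ℕ} [NeZero N']
    (D' : ModularParametrizationData W' N')
    (hopt : ∀ z ∈ D'.L.lattice, ∃ w ∈ periodLattice D'.f, z = D'.c * w) (hN : N' ≤ 500000)
    (p : ℕ) [hp : Fact p.Prime] : padicValInt p D'.maninConstant = 0 :=
  padicValInt.eq_zero_of_not_dvd (not_dvd_maninConstant_of_level_le_500000 h W' D' hopt hN hp.out)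

end Literature.NumberTheory.EllipticCurves
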